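import Summits.CriticalPhenomena.PercolationContinuityZ3.Theorems.SahiCISNonClosure
import Summits.CriticalPhenomena.PercolationContinuityZ3.Theorems.SahiCISPositivity
import Summits.CriticalPhenomena.PercolationContinuityZ3.Theorems.SahiPositivityWeakLimitsCube

/-!
# Weak limits of CIS laws: not CIS, but still positively associated and Sahi-positive

Cell `prim-sahi`, typer (generation 17); `--supports stmt-CriticalPhenomena-4575`.  Theorems only (no definitions,
no named facts, no sorries).

`SahiCISNonClosure.lean` shows that a weak limit of CIS laws on `[0,1]³` need not be CIS.  The CONSEQUENCES of CIS
nevertheless pass to weak limits, because order-`n` Sahi positivity is weakly closed (`SahiPositivityWeakLimitsCube`,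
generation 14) — this file records the resulting statements:

* `msahiE_nonneg_of_tendsto_isCISae` — a weak limit (along any filter) of `IsCISae` probability laws on `Q_d` is
  Sahi-positive of order `n` on all measurable nonnegative monotone families, given `LiebSahiContinuum d n`;
  unconditional layers `_of_le_two`, `_of_order_le_two`, `_three` (`E₃ ≥ 0` on `[0,1]³`);
* `isPositivelyAssociated_of_tendsto_isCISae` — such a limit is positively associated;
* `msahiE_three_nonneg_fourAtomLaw_zero` — in particular the non-CIS limit law `fourAtomLaw 0 0` of
  `SahiCISNonClosure.lean` satisfies `E₃ ≥ 0` (and is positively associated).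

References: Colangelo–Müller–Scarsini 2006 (B6) [ColangeloMullerScarsini2006].  Statements are this work.
-/

noncomputable section

namespace Summit.CriticalPhenomena.PercolationContinuityZ3.Theorems.SahiCIS

open MeasureTheory ProbabilityTheory Set Filter Topology Function
open Summit.CriticalPhenomena.PercolationContinuityZ3.Theorems.SahiBoxTP2
open Summit.CriticalPhenomena.PercolationContinuityZ3.Theorems.SahiWeakLimits
open Literature.Combinatorics.Sahi2008 Literature.Probability.Percolation
open scoped ENNReal unitInterval

variable {d n : ℕ} {ι : Type*} {L : Filter ι} [NeBot L]

/-- **Weak limits of CIS laws are Sahi-positive of order `n`, given `L(d,n)`** (every filter; all measurable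
nonnegative monotone families). [this work] -/
theorem msahiE_nonneg_of_tendsto_isCISae (hL : LiebSahiContinuum d n) {μs : ι → ProbabilityMeasure (Fin d → I)}
    {μ : ProbabilityMeasure (Fin d → I)} (hconv : Tendsto μs L (𝓝 μ))
    (h : ∀ᶠ k in L, IsCISae d (μs k : Measure (Fin d → I))) (f : Fin n → (Fin d → I) → ℝ)
    (hfm : ∀ i, Measurable (f i)) (hf0 : ∀ i x, 0 ≤ f i x) (hmono : ∀ i, Monotone (f i)) :
    0 ≤ msahiE (μ : Measure (Fin d → I)) n f :=
  msahiE_nonneg_of_tendsto_cube' hconv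
    (h.mono fun _ hk g hgm hgmono hg0 => hk.msahiE_nonneg hL _ g hgm hg0 hgmono) f hfm hf0 hmono

/-- Unconditional, `d ≤ 2`. [this work] -/
theorem msahiE_nonneg_of_tendsto_isCISae_of_le_two (hd : d ≤ 2) {μs : ι → ProbabilityMeasure (Fin d → I)}
    {μ : ProbabilityMeasure (Fin d → I)} (hconv : Tendsto μs L (𝓝 μ))
    (h : ∀ᶠ k in L, IsCISae d (μs k : Measure (Fin d → I))) (f : Fin n → (Fin d → I) → ℝ)
    (hfm : ∀ i, Measurable (f i)) (hf0 : ∀ i x, 0 ≤ f i x) (hmono : ∀ i, Monotone (f i)) :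
    0 ≤ msahiE (μ : Measure (Fin d → I)) n f :=
  msahiE_nonneg_of_tendsto_isCISae (liebSahiContinuum_of_le_two hd n) hconv h f hfm hf0 hmono

/-- Unconditional, `n ≤ 2`. [this work] -/
theorem msahiE_nonneg_of_tendsto_isCISae_of_order_le_two (hn : n ≤ 2) {μs : ι → ProbabilityMeasure (Fin d → I)}
    {μ : ProbabilityMeasure (Fin d → I)} (hconv : Tendsto μs L (𝓝 μ))
    (h : ∀ᶠ k in L, IsCISae d (μs k : Measure (Fin d → I))) (f : Fin n → (Fin d → I) → ℝ)
    (hfm : ∀ i, Measurable (f i)) (hf0 : ∀ i x, 0 ≤ f i x) (hmono : ∀ i, Monotone (f i)) :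
    0 ≤ msahiE (μ : Measure (Fin d → I)) n f :=
  msahiE_nonneg_of_tendsto_isCISae (liebSahiContinuum_of_order_le_two d hn) hconv h f hfm hf0 hmono

/-- **Unconditional: a weak limit of CIS laws on `[0,1]³` satisfies `E₃ ≥ 0`.** [this work] -/
theorem msahiE_three_nonneg_of_tendsto_isCISae {μs : ι → ProbabilityMeasure (Fin 3 → I)}
    {μ : ProbabilityMeasure (Fin 3 → I)} (hconv : Tendsto μs L (𝓝 μ))
    (h : ∀ᶠ k in L, IsCISae 3 (μs k : Measure (Fin 3 → I))) (f : Fin 3 → (Fin 3 → I) → ℝ)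
    (hfm : ∀ i, Measurable (f i)) (hf0 : ∀ i x, 0 ≤ f i x) (hmono : ∀ i, Monotone (f i)) :
    0 ≤ msahiE (μ : Measure (Fin 3 → I)) 3 f :=
  msahiE_nonneg_of_tendsto_isCISae (SahiGridPattern.liebSahiContinuum_of_patternPos fun A B C =>
    SahiGridPattern.sStarD_three_nonneg A B C) hconv h f hfm hf0 hmono

/-- **Weak limits of CIS laws are positively associated.** [this work] -/
theorem isPositivelyAssociated_of_tendsto_isCISae {μs : ι → ProbabilityMeasure (Fin d → I)}
    {μ : ProbabilityMeasure (Fin d → I)} (hconv : Tendsto μs L (𝓝 μ))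
    (h : ∀ᶠ k in L, IsCISae d (μs k : Measure (Fin d → I))) : IsPositivelyAssociated (μ : Measure (Fin d → I)) := by
  refine isPositivelyAssociated_of_indicator (μ : Measure (Fin d → I)) fun A B hA hB hAm hBm => ?_
  obtain ⟨hAmo, hAme, hA0, -⟩ := indicator_one_props hA hAm
  obtain ⟨hBmo, hBme, hB0, -⟩ := indicator_one_props hB hBm
  have h2 := msahiE_nonneg_of_tendsto_isCISae_of_order_le_two le_rfl hconv h ![A.indicator 1, B.indicator 1]
    (fun i => by fin_cases i <;> assumption) (fun i => by fin_cases i <;> assumption)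
    (fun i => by fin_cases i <;> assumption)
  rw [msahiE_two] at h2
  linarith

/-- **The non-CIS limit law `fourAtomLaw 0 0` of `SahiCISNonClosure.lean` satisfies `E₃ ≥ 0`** (it is a weak limit of
CIS laws). [this work] -/
theorem msahiE_three_nonneg_fourAtomLaw_zero (f : Fin 3 → (Fin 3 → I) → ℝ) (hfm : ∀ i, Measurable (f i))
    (hf0 : ∀ i x, 0 ≤ f i x) (hmono : ∀ i, Monotone (f i)) : 0 ≤ msahiE (fourAtomLaw ⊥ ⊥) 3 f :=
  msahiE_three_nonneg_of_tendsto_isCISae (L := atTop) (μs := fun k => fourAtomPM ⊥ (tSeq k))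
    (tendsto_fourAtomLaw tendsto_const_nhds tendsto_tSeq)
    (Eventually.of_forall fun k => isCISae_fourAtomLaw (bot_lt_tSeq k)) f hfm hf0 hmono

/-- … and is positively associated, though not CIS. [this work] -/
theorem isPositivelyAssociated_fourAtomLaw_zero : IsPositivelyAssociated (fourAtomLaw ⊥ ⊥) :=
  isPositivelyAssociated_of_tendsto_isCISae (L := atTop) (μs := fun k => fourAtomPM ⊥ (tSeq k))
    (tendsto_fourAtomLaw tendsto_const_nhds tendsto_tSeq)
    (Eventually.of_forall fun k => isCISae_fourAtomLaw (bot_lt_tSeq k))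

end Summit.CriticalPhenomena.PercolationContinuityZ3.Theorems.SahiCIS

end
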